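import Summits.Ventures.PercRepro.C026EdgeMonoMain

/-!
# THEOREM R from the LOOP-FREE form of CONJECTURE EM (p5, gen 17)

A loop changes no connectivity, so `Δ_CF(H) = 2·Δ_CF(H − e)` for every loop `e` (`slackCF_loop`):
EM at a loop, `Δ_CF(H − e) ≤ Δ_CF(H)`, is exactly (CF) for `H − e`. The predicate `EdgeMono`
(C026EdgeMono) quantifies over loops too, so it contains (CF) outright; the honest form of
mine-3's conjecture is its LOOP-FREE part `EdgeMonoNL` — the off-mark edges `x–y`, `c–x` of
INBOX 6152 with two distinct ends. Here THEOREM R is proved from `EdgeMonoNL`, and the two forms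
are shown equivalent.

* `conn_addEdge_self_iff`, `slackCF_addEdge_self`, `slackCF_loop` — the loop identity;
* `EdgeMonoNL a b c` — CONJECTURE EM for loop-free off-mark edges; `edgeMonoNL_of_edgeMono`;
* `slackCF_part_le_of_edgeMonoNL` — EM for a set of off-mark edges (loops allowed in the set)
  from the loop-free form, given `0 ≤ Δ_CF` of the stripped graph;
* **`slackCF_nonneg_of_edgeMonoNL_of_hubFactor`**, **`edgeMono_of_edgeMonoNL_of_hubFactor`** —
  (R2) from the loop-free form, by the induction of C026EdgeMono; hence `EdgeMono`;
* **`edgeMono_iff_edgeMonoNL`**, **`slackCF_nonneg_of_edgeMonoNL`**, **`mono_of_edgeMonoNL`**,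
  `c026_of_edgeMonoNL` — unconditional (the hub factor discharged in C026EdgeMonoMain).
-/

universe u v

namespace PercRepro

open Finset

namespace MultiGraph

section Loop

variable {V : Type u} {E : Type v} {G : MultiGraph V E}

/-- A loop changes no connectivity: with the loop `none` of `G + xx` in any state, `H` connects
`p` to `q` iff `G` does. -/
theorem conn_addEdge_self_iff {x : V} (s : Bool) {ω : Config E} {p q : V} :
    (G.addEdge x x).Conn (extendOpt s ω) p q ↔ G.Conn ω p q := by
  cases s
  · exact conn_addEdge_closed_iff
  · rw [conn_addEdge_open_iff]
    constructor
    · rintro (h | ⟨hp | hp, hq | hq⟩)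
      · exact h
      all_goals exact hp.trans hq.symm
    · intro h
      exact Or.inl h

open Classical in
/-- **A loop doubles `Δ_CF`**: `Δ_CF(G + xx) = 2·Δ_CF(G)`. -/
theorem slackCF_addEdge_self [Fintype E] (G : MultiGraph V E) (x a b c : V) :
    (G.addEdge x x).slackCF a b c = 2 * G.slackCF a b c := by
  have h1 : (univ.filter fun τ : Config (Option E) =>
      (G.addEdge x x).Conn τ a b ∧ ¬ (G.addEdge x x).Conn τ a c).card =
      2 * (univ.filter fun ω : Config E => G.Conn ω a b ∧ ¬ G.Conn ω a c).card := by
    rw [card_filter_option]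
    simp only [conn_addEdge_self_iff]
    ring
  have h2 : (univ.filter fun τ : Config (Option E) =>
      (G.addEdge x x).Conn τ c a ∧ ¬ (G.addEdge x x).Conn τ c b).card =
      2 * (univ.filter fun ω : Config E => G.Conn ω c a ∧ ¬ G.Conn ω c b).card := by
    rw [card_filter_option]
    simp only [conn_addEdge_self_iff]
    ring
  have h3 : (univ.filter fun τ : Config (Option E) =>
      (G.addEdge x x).Conn τ c b ∧ ¬ (G.addEdge x x).Conn τ c a).card =
      2 * (univ.filter fun ω : Config E => G.Conn ω c b ∧ ¬ G.Conn ω c a).card := by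
    rw [card_filter_option]
    simp only [conn_addEdge_self_iff]
    ring
  have h4 : (univ.filter fun τ : Config (Option E) =>
      (G.addEdge x x).Conn τ a b ∧ ¬ (G.addEdge x x).Conn τᶜ c a ∧
        ¬ (G.addEdge x x).Conn τᶜ c b).card =
      2 * (univ.filter fun ω : Config E =>
        G.Conn ω a b ∧ ¬ G.Conn ωᶜ c a ∧ ¬ G.Conn ωᶜ c b).card := by
    rw [card_filter_option]
    simp only [compl_extendOpt, conn_addEdge_self_iff]
    ring
  have key : ((univ.filter fun τ : Config (Option E) =>
        (G.addEdge x x).Conn τ a b ∧ ¬ (G.addEdge x x).Conn τ a c).card : ℤ) +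
      ((univ.filter fun τ : Config (Option E) =>
        (G.addEdge x x).Conn τ c a ∧ ¬ (G.addEdge x x).Conn τ c b).card : ℤ) +
      ((univ.filter fun τ : Config (Option E) =>
        (G.addEdge x x).Conn τ c b ∧ ¬ (G.addEdge x x).Conn τ c a).card : ℤ) -
      ((univ.filter fun τ : Config (Option E) =>
        (G.addEdge x x).Conn τ a b ∧ ¬ (G.addEdge x x).Conn τᶜ c a ∧
          ¬ (G.addEdge x x).Conn τᶜ c b).card : ℤ) =
      2 * (((univ.filter fun ω : Config E => G.Conn ω a b ∧ ¬ G.Conn ω a c).card : ℤ) +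
        ((univ.filter fun ω : Config E => G.Conn ω c a ∧ ¬ G.Conn ω c b).card : ℤ) +
        ((univ.filter fun ω : Config E => G.Conn ω c b ∧ ¬ G.Conn ω c a).card : ℤ) -
        ((univ.filter fun ω : Config E =>
          G.Conn ω a b ∧ ¬ G.Conn ωᶜ c a ∧ ¬ G.Conn ωᶜ c b).card : ℤ)) := by
    rw [h1, h2, h3, h4]
    push_cast
    ring
  unfold slackCF
  convert key using 8

open Classical in
/-- **Deleting a loop halves `Δ_CF`**: `Δ_CF(H) = 2·Δ_CF(H − e)` for a loop `e`. -/
theorem slackCF_loop [Fintype E] (H : MultiGraph V E) {e : E} (he : H.fst e = H.snd e)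
    (a b c : V) : H.slackCF a b c = 2 * (H.part (delEdgeSide e) true).slackCF a b c := by
  rw [← slackCF_relabel (isRelabel_addEdge_delEdge H e), he]
  exact slackCF_addEdge_self _ _ a b c

end Loop

section LoopFree

variable {V : Type u}

open Classical in
/-- **CONJECTURE EM, loop-free form** (mine-3, INBOX 6152: the off-mark edges `x–y` and `c–x`):
deleting an edge with two distinct ends, neither of them `a` or `b`, never increases `Δ_CF`. -/
def EdgeMonoNL (a b c : V) : Prop :=
  ∀ (E : Type v) [Fintype E] (H : MultiGraph V E) (e : E), H.fst e ≠ H.snd e →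
    ¬ H.EdgeAt e a → ¬ H.EdgeAt e b →
    (H.part (delEdgeSide e) true).slackCF a b c ≤ H.slackCF a b c

/-- The loop-free form is weaker. -/
theorem edgeMonoNL_of_edgeMono {a b c : V} (h : EdgeMono.{u, v} a b c) :
    EdgeMonoNL.{u, v} a b c :=
  fun E _ H e _ hea heb => h E H e hea heb

open Classical in
/-- **EM for a set of edges from the loop-free form**: deleting any set of off-mark edges (loops
included) never increases `Δ_CF`, provided the stripped graph has `0 ≤ Δ_CF` (put the edges back
one at a time: a loop doubles a nonnegative slack, a loop-free edge is EM). -/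
theorem slackCF_part_le_of_edgeMonoNL {a b c : V} (hE : EdgeMonoNL.{u, v} a b c) {E : Type v}
    [Fintype E] (H : MultiGraph V E) (keep : E → Bool)
    (hoff : ∀ e, keep e = false → ¬ H.EdgeAt e a ∧ ¬ H.EdgeAt e b)
    (h0 : 0 ≤ (H.part keep true).slackCF a b c) :
    (H.part keep true).slackCF a b c ≤ H.slackCF a b c := by
  suffices h : ∀ n : ℕ, ∀ keep : E → Bool, (univ.filter fun e => keep e = false).card = n →
      (∀ e, keep e = false → ¬ H.EdgeAt e a ∧ ¬ H.EdgeAt e b) →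
      0 ≤ (H.part keep true).slackCF a b c →
      (H.part keep true).slackCF a b c ≤ H.slackCF a b c from h _ keep rfl hoff h0
  intro n
  induction n with
  | zero =>
    intro keep hn _ _
    have hall : ∀ e, keep e = true := by
      intro e
      by_contra h
      have hmem : e ∈ univ.filter fun e => keep e = false := by
        simp only [Finset.mem_filter, Finset.mem_univ, true_and]
        exact Bool.eq_false_iff.mpr h
      rw [Finset.card_eq_zero] at hn
      rw [hn] at hmem
      exact Finset.notMem_empty e hmem
    rw [slackCF_relabel (isRelabel_part_of_forall H keep hall)]
  | succ n ih =>
    intro keep hn hoff h0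
    obtain ⟨e₀, he₀⟩ : ∃ e, keep e = false := by
      obtain ⟨e, he⟩ :=
        Finset.card_pos.1 (by omega : 0 < (univ.filter fun e => keep e = false).card)
      exact ⟨e, (Finset.mem_filter.1 he).2⟩
    have hn' : (univ.filter fun e => keepInsert keep e₀ e = false).card = n := by
      have hset : (univ.filter fun e => keepInsert keep e₀ e = false) =
          (univ.filter fun e => keep e = false).erase e₀ := by
        ext e
        simp only [Finset.mem_filter, Finset.mem_univ, true_and, Finset.mem_erase,
          keepInsert_eq_false_iff]
        tauto
      rw [hset, Finset.card_erase_of_mem (by simpa using he₀), hn]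
      rfl
    have hoff' : ∀ e, keepInsert keep e₀ e = false → ¬ H.EdgeAt e a ∧ ¬ H.EdgeAt e b :=
      fun e he => hoff e ((keepInsert_eq_false_iff keep e₀ e).1 he).1
    -- `H₁ = H.part keep' true`; `H₁ − e₀` is `H.part keep true`
    have hrel := slackCF_relabel (isRelabel_delEdge H keep he₀) a b c
    have hstep : (H.part keep true).slackCF a b c ≤
        (H.part (keepInsert keep e₀) true).slackCF a b c := by
      by_cases hl : H.fst e₀ = H.snd e₀
      · -- a loop: `Δ(H₁) = 2·Δ(H₁ − e₀) ≥ Δ(H₁ − e₀)`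
        have h2 := slackCF_loop (H.part (keepInsert keep e₀) true)
          (e := ⟨e₀, keepInsert_self keep e₀⟩) hl a b c
        rw [hrel] at h2
        rw [h2]
        linarith
      · -- loop-free: EM
        have h2 := hE _ (H.part (keepInsert keep e₀) true) ⟨e₀, keepInsert_self keep e₀⟩ hl
          (hoff e₀ he₀).1 (hoff e₀ he₀).2
        rwa [hrel] at h2
    exact hstep.trans (ih _ hn' hoff' (h0.trans hstep))

open Classical in
/-- The stripped graph `H′` (the off-mark edges at `u` deleted, loops included): `Δ_CF(H′) =
m·Δ_CF(H − u)` with `m ≥ 1` ((R0)), and `Δ_CF(H′) ≤ Δ_CF(H)` once `0 ≤ Δ_CF(H − u)` (EM). -/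
theorem slackCF_keepHub_of_edgeMonoNL {a b c : V} (hF : HubFactor.{u, v} a b c)
    (hE : EdgeMonoNL.{u, v} a b c) {E : Type v} [Fintype E] (H : MultiGraph V E) {u : V}
    (hua : u ≠ a) (hub : u ≠ b) (huc : u ≠ c) :
    ∃ m : ℤ, 1 ≤ m ∧ (H.part (H.keepHub u a b) true).slackCF a b c =
        m * (H.part (H.delSide u) true).slackCF a b c ∧
      (0 ≤ (H.part (H.delSide u) true).slackCF a b c →
        (H.part (H.keepHub u a b) true).slackCF a b c ≤ H.slackCF a b c) := by
  obtain ⟨m, hm1, hm⟩ :=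
    hF _ (H.part (H.keepHub u a b) true) u hua hub huc (part_keepHub_hub H u a b)
  rw [slackCF_relabel (isRelabel_hubDel H u a b)] at hm
  refine ⟨m, hm1, hm, fun h0 => ?_⟩
  refine slackCF_part_le_of_edgeMonoNL hE H _
    (fun e he => ((keepHub_eq_false_iff H u a b e).1 he).2) ?_
  rw [hm]
  exact mul_nonneg (by linarith) h0

open Classical in
/-- The induction of (R2) from the loop-free form (the induction of `slackCF_nonneg_of_edgeMono_aux`
with `slackCF_keepHub_of_edgeMonoNL` at the step). -/
theorem slackCF_nonneg_of_edgeMonoNL_aux {a b c : V} (hF : HubFactor.{u, v} a b c)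
    (hE : EdgeMonoNL.{u, v} a b c) (m : ℕ) :
    ∀ (E : Type v) [Fintype E] (G : MultiGraph V E), (G.nonMarkSupp a b c).card = m →
      0 ≤ G.slackCF a b c := by
  induction m using Nat.strong_induction_on with
  | _ m ih =>
    intro E _ G hm
    by_cases hu : ∃ u, u ≠ a ∧ u ≠ b ∧ u ≠ c ∧ ∃ e, G.EdgeAt e u ∧ (G.EdgeAt e a ∨ G.EdgeAt e b)
    · obtain ⟨u, hua, hub, huc, e, heu, hea⟩ := hu
      have hmem : u ∈ G.nonMarkSupp a b c :=
        Finset.mem_filter.mpr ⟨(mem_supp G u).mpr ⟨e, heu⟩, hua, hub, huc⟩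
      have hlt := card_nonMarkSupp_del_lt G (a := a) (b := b) (c := c) hmem
      rw [hm] at hlt
      have h1 : 0 ≤ (G.part (G.delSide u) true).slackCF a b c :=
        ih _ hlt _ (G.part (G.delSide u) true) rfl
      obtain ⟨k, hk1, hk, h2⟩ := slackCF_keepHub_of_edgeMonoNL hF hE G hua hub huc
      refine le_trans ?_ (h2 h1)
      rw [hk]
      exact mul_nonneg (by linarith) h1
    · push Not at hu
      refine slackCF_nonneg_of_components a b c fun κ _ => ?_
      refine slackCF_nonneg_of_isolated (Or.inl fun e' he' => ?_)
      have he'a : G.EdgeAt e'.1 a := he'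
      rcases nonMark_end_of_compColour_inl e'.2 with hw | hw
      · simp only [Set.mem_insert_iff, Set.mem_singleton_iff, not_or] at hw
        exact (hu (G.fst e'.1) hw.1 hw.2.1 hw.2.2 e'.1 (Or.inl rfl)).1 he'a
      · simp only [Set.mem_insert_iff, Set.mem_singleton_iff, not_or] at hw
        exact (hu (G.snd e'.1) hw.1 hw.2.1 hw.2.2 e'.1 (Or.inr rfl)).1 he'a

/-- **THEOREM R (R2) from the loop-free form, modulo the hub factor.** -/
theorem slackCF_nonneg_of_edgeMonoNL_of_hubFactor {a b c : V} (hF : HubFactor.{u, v} a b c)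
    (hE : EdgeMonoNL.{u, v} a b c) {E : Type v} [Fintype E] (G : MultiGraph V E) :
    0 ≤ G.slackCF a b c :=
  slackCF_nonneg_of_edgeMonoNL_aux hF hE _ E G rfl

open Classical in
/-- **The loop-free form gives the full form, modulo the hub factor**: at a loop, `Δ_CF(H) =
2·Δ_CF(H − e) ≥ Δ_CF(H − e)` because `0 ≤ Δ_CF(H − e)` by (R2). -/
theorem edgeMono_of_edgeMonoNL_of_hubFactor {a b c : V} (hF : HubFactor.{u, v} a b c)
    (hE : EdgeMonoNL.{u, v} a b c) : EdgeMono.{u, v} a b c := by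
  intro E _ H e hea heb
  by_cases hl : H.fst e = H.snd e
  · rw [slackCF_loop H hl a b c]
    have := slackCF_nonneg_of_edgeMonoNL_of_hubFactor hF hE (H.part (delEdgeSide e) true)
    linarith
  · exact hE E H e hl hea heb

/-- **The two forms of CONJECTURE EM are equivalent** (the hub factor discharged): the loop-free
form already carries everything. -/
theorem edgeMono_iff_edgeMonoNL (a b c : V) : EdgeMono.{u, v} a b c ↔ EdgeMonoNL.{u, v} a b c :=
  ⟨edgeMonoNL_of_edgeMono, edgeMono_of_edgeMonoNL_of_hubFactor (hubFactor a b c)⟩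

/-- **THEOREM R (R2), loop-free form**: CONJECTURE EM for loop-free off-mark edges gives
`0 ≤ Δ_CF` on every marked multigraph. -/
theorem slackCF_nonneg_of_edgeMonoNL {a b c : V} (hE : EdgeMonoNL.{u, v} a b c) {E : Type v}
    [Fintype E] (G : MultiGraph V E) : 0 ≤ G.slackCF a b c :=
  slackCF_nonneg_of_edgeMono ((edgeMono_iff_edgeMonoNL a b c).2 hE) G

/-- **THEOREM R (R1), loop-free form**: CONJECTURE EM for loop-free off-mark edges implies
CONJECTURE MONO (ROW C-031). -/
theorem mono_of_edgeMonoNL {a b c : V} (hE : EdgeMonoNL.{u, v} a b c) : Mono.{u, v} a b c :=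
  mono_of_edgeMono ((edgeMono_iff_edgeMonoNL a b c).2 hE)

/-- CONJECTURE EM (loop-free, every marking) gives C-026 at every edge weight. -/
theorem c026_of_edgeMonoNL (hE : ∀ (V' : Type u) (a b c : V'), EdgeMonoNL.{u, v} a b c)
    {E : Type v} [Fintype E] [DecidableEq E] (G : MultiGraph V E) (a b c : V) (p : E → ℝ)
    (hp : IsProb p) :
    (G.law3 p a b c 0 + G.law3 p a b c 1) * (G.law3 p a b c 1 + G.law3 p a b c 4) ≤
      G.law3 p a b c 1 + G.law3 p a b c 2 + G.law3 p a b c 3 :=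
  c026_of_edgeMono (fun V' a b c => (edgeMono_iff_edgeMonoNL a b c).2 (hE V' a b c)) G a b c p hp

end LoopFree

end MultiGraph

end PercRepro
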